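import Summits.BirchSwinnertonDyer.BirchSwinnertonDyer.Theses.TameQuarticManinParity
import HarnessLib

/-!
# Route `TameQuarticManinParity`, LINE 42 (bsd-idea-3 g12), glue G42* `TprimeTameStarredOfTraceDivisible`
# — S* ∧ N42*′ ⟹ E57′, PROVED BY NAME, carrier-free (the planner's `ItemsInline42b.lean` / `Sketch42b.lean`)

Cell `pub/bsd-wall`, D-0145 line `route-BirchSwinnertonDyer-TeichmullerTwistDescent`, seat `bsd-line-ttd-p1` g15.
BSD is NOT proved by this; Manin's conjecture is not proved by this; the cruxes S* (`TprimeStarredNeronTraceDivisible`)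
and N42*′ (`TprimeStarredNeronCongruenceDepth`) and the III* cell E57′ (`TprimeTameStarredOptimalManinUnit`, 24046)
stay OPEN. This file closes ONLY the glue.

## Proof (pure valuation arithmetic)

N42*′ gives a cusp-regular rational `g` with `⟨f,g⟩ = t⟨f,f⟩`, `t ≠ 0`, `v₃(t) + v₃(deg φ) ≤ 1`; S* gives
`deg φ·⟨f,g⟩ = t'·3·c·⟨f,f⟩` with `v₃(t') ≥ 0`; `⟨f,f⟩ ≠ 0` (Petersson positivity), so `deg φ·t = 3t'c` and
`v₃(deg φ) + v₃(t) = v₃(t') + 1 + v₃(c) ≥ 1 + v₃(c)`, whence `v₃(c) ≤ 0`. THEOREMS ONLY; axioms `propext`,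
`Classical.choice`, `Quot.sound`.
-/

set_option autoImplicit false
-- D-0017: single-problem summit, so `Summit.BirchSwinnertonDyer.BirchSwinnertonDyer.…` repeats a namespace BY DESIGN.
set_option linter.dupNamespace false

namespace Summit.BirchSwinnertonDyer.BirchSwinnertonDyer.Theorems.TameQuarticManinParity

open scoped MatrixGroups ModularForm
open CongruenceSubgroup
open Summit.BirchSwinnertonDyer.BirchSwinnertonDyer.Theses.TameQuarticManinParity
open Literature.NumberTheory.EllipticCurves.ModularForms

/-- **The arithmetic of the two III* lower bounds** (`s ≥ 1` as trace divisibility, `ñ ≥ δ − 1` as a witness):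
`deg φ·t = 3·t'·c` with `v₃(t') ≥ 0`, `v₃(t) + v₃(deg φ) ≤ 1` ⟹ `3 ∤ c`. Carrier-free.
[cite: AbbesUllmo1996, Lemme 3.1] -/
theorem not_dvd_maninConstant_of_traceDiv_of_witness {N : ℕ} [NeZero N]
    {W : WeierstrassCurve ℚ} (D : ModularParametrizationData W N)
    {g : CuspForm (Gamma0 N) 2} {t t' : ℚ} (ht0 : t ≠ 0)
    (hv : padicValRat 3 t + padicValNat 3 D.modularDegree ≤ 1) (ht' : 0 ≤ padicValRat 3 t')
    (hfg : peterssonProduct (Gamma0 N) 2 D.f g = (t : ℂ) * peterssonProduct (Gamma0 N) 2 D.f D.f)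
    (htr : (D.modularDegree : ℂ) * peterssonProduct (Gamma0 N) 2 D.f g =
      (t' : ℂ) * 3 * (D.maninConstant : ℂ) * peterssonProduct (Gamma0 N) 2 D.f D.f) :
    ¬ (3 : ℤ) ∣ D.maninConstant := by
  haveI : Fact (Nat.Prime 3) := ⟨Nat.prime_three⟩
  have hff : peterssonProduct (Gamma0 N) 2 D.f D.f ≠ 0 := by
    intro h
    have hpos := peterssonProduct_self_pos_holds (Gamma0 N) 2
      (IsNormalized.ne_zero D.isNewformOf.1.2.2)
    rw [h, Complex.zero_re] at hpos
    exact lt_irrefl _ hpos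
  rw [hfg, ← mul_assoc] at htr
  have hdeg : (D.modularDegree : ℂ) * (t : ℂ) = (t' : ℂ) * 3 * (D.maninConstant : ℂ) :=
    mul_right_cancel₀ hff htr
  have hdegQ : (D.modularDegree : ℚ) * t = (t' * 3) * D.maninConstant := by exact_mod_cast hdeg
  have hd0 : (D.modularDegree : ℚ) ≠ 0 := by exact_mod_cast D.deg_pos.ne'
  have hc0 : (D.maninConstant : ℚ) ≠ 0 := by
    exact_mod_cast ModularParametrizationData.maninConstant_ne_zero_holds D
  have ht'0 : t' ≠ 0 := by
    intro h; rw [h, zero_mul, zero_mul] at hdegQ; exact (mul_ne_zero hd0 ht0) hdegQ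
  have h30 : (t' * 3 : ℚ) ≠ 0 := mul_ne_zero ht'0 (by norm_num)
  have hval : padicValRat 3 (D.modularDegree : ℚ) + padicValRat 3 t =
      (padicValRat 3 t' + padicValRat 3 (3 : ℚ)) + padicValRat 3 (D.maninConstant : ℚ) := by
    rw [← padicValRat.mul hd0 ht0, hdegQ, padicValRat.mul h30 hc0, padicValRat.mul ht'0 (by norm_num)]
  have h3v : padicValRat 3 (3 : ℚ) = 1 := by
    have := @padicValRat.self 3 (by norm_num : 1 < 3)
    exact_mod_cast this
  rw [← padicValRat_of_nat, padicValRat.of_int, h3v] at hval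
  intro h3
  have hc1 : 1 ≤ padicValInt 3 D.maninConstant := by
    rcases (padicValInt_dvd_iff (p := 3) 1 D.maninConstant).1 (by simpa using h3) with h0 | h1
    · exact absurd h0 (ModularParametrizationData.maninConstant_ne_zero_holds D)
    · exact h1
  have : (1 : ℤ) ≤ padicValInt 3 D.maninConstant := by exact_mod_cast hc1
  push_cast at hval hv
  linarith

/-- **Glue G42*** (`TprimeTameStarredOfTraceDivisible`), by name: S* ∧ N42*′ ⟹ E57′ on the (t′) III* cell.
[cite: AbbesUllmo1996, Lemme 3.1] -/
theorem tprimeTameStarredOfTraceDivisible_proof : TprimeTameStarredOfTraceDivisible := by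
  unfold TprimeTameStarredOfTraceDivisible TprimeTameStarredOptimalManinUnit
  intro hS h42 W _ _ _ hadd ht h9 D hopt hmin
  obtain ⟨g, hrat, hreg, t, ht0, hv, hfg⟩ := h42 W hadd ht h9 D hopt hmin
  obtain ⟨t', ht', htr⟩ := hS W hadd ht h9 D hopt hmin g hrat hreg
  exact not_dvd_maninConstant_of_traceDiv_of_witness D ht0 hv ht' hfg htr

end Summit.BirchSwinnertonDyer.BirchSwinnertonDyer.Theorems.TameQuarticManinParity
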